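import Summits.PneNP.PneNP.Theorems.RegularResolutionRung.Negative.EmptyGraphLines
import Literature.Computability.MetaComplexity.ResolutionStepLists

/-!
# `ResolutionUncertainty` (stmt-PneNP-9816): the brute-force refutation fixes the scale of the conjecture

Calibration lemmas for the support item `Summit.PneNP.PneNP.Theses.RamseyUncertifiable.ResolutionUncertainty`,
ported into the importable tree from the standing disprover's crux workfile
`Cruxes/ResolutionUncertainty/Disproof.lean` (seat `refuter-cdisprove-stmt-PneNP-9816-0`, 2026-08-15/16;
statements and proofs unchanged, re-based on the Theorems-side `cliqueCNF` of
`RegularResolutionRung/Negative/EmptyGraphLines.lean`, the same term as the route's inline `cnf`).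

* `resolutionUncertainty_iff_cliqueCNF` — read-back (`Iff.rfl`).
* `exists_refutation_le_count` / `_le_pow` / `_le_pow_cliqueNum` — for EVERY adjacency table without a
  consistent `k`-assignment, `Clique(adj, k)` has a resolution refutation with `≤ 4(n+1) Σ_{t≤k} C_t ≤
  4(k+1)(n+1)^{k+1}` lines (`C_t` = #consistent `Fin t → Fin n`), `≤ 4(w+1)(n+1)^{w+1}` if `ω ≤ w` (any `k`).
* `exists_refutation_at_threshold[_cliqueNum]` (registered stub) — at `k(n) = ⌈log₂ n²⌉` the item's `max`
  is `≤ n^{min(ω,α)+O(1)} ≤ n^{(2+o(1)) log₂ n}`: TRUE ⇒ `ε ≤ 2` (`ε ≤ 1/2` in `HalfBoundary.lean`).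
  [folklore; ABdRLNR21 arXiv:2012.09476 §2 (the `n^{O(k)}` upper bound)]
-/

-- the mandated namespace `Summit.PneNP.PneNP.…` (summit = problem = `PneNP`) repeats `PneNP` by design
set_option linter.dupNamespace false

namespace Summit.PneNP.PneNP.Theorems.ResolutionUncertainty.Negative

open Literature.Computability.Complexity Literature.Computability.MetaComplexity
open Summit.PneNP.PneNP.Theses.RamseyUncertifiable
open Summit.PneNP.PneNP.Theorems.RegularResolutionRung.Negative (cliqueCNF)

/-- The Erdős threshold `k(n) = ⌈log₂ (n²)⌉ = ⌈2 log₂ n⌉` of the item. -/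
abbrev kR (n : ℕ) : ℕ := Nat.clog 2 (n ^ 2)

/-- Read-back: the route decl `ResolutionUncertainty` is, definitionally, the statement over the named
unary clique CNF `cliqueCNF` at the threshold `kR` (its `let`s unfolded). -/
theorem resolutionUncertainty_iff_cliqueCNF :
    ResolutionUncertainty ↔
      ∃ ε : ℝ, 0 < ε ∧ ∃ n₀ : ℕ, ∀ n ≥ n₀, ∀ (G : SimpleGraph (Fin n)) [DecidableRel G.Adj],
        ∀ π₁ π₂ : List (ResLine ℕ),
          IsResRefutation (cliqueCNF n (kR n) fun u v => decide (G.Adj u v)) π₁ →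
          IsResRefutation (cliqueCNF n (kR n) fun u v => decide (Gᶜ.Adj u v)) π₂ →
          (n : ℝ) ^ (ε * Real.logb 2 n) ≤ max (π₁.length : ℝ) (π₂.length : ℝ) :=
  Iff.rfl

/-- The clique-member clause of block `i < k` is an axiom. -/
theorem clique_mem_cliqueCNF {n k : ℕ} (adj : Fin n → Fin n → Bool) {i : ℕ} (hi : i < k) :
    ((List.finRange n).map fun v => (i * n + (v : ℕ), true)) ∈ cliqueCNF n k adj := by
  unfold cliqueCNF
  refine List.mem_append_left _ (List.mem_append_left _ ?_)
  exact List.mem_map.2 ⟨i, List.mem_range.2 hi, rfl⟩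

/-- In the clique-member and functionality blocks the vertex binders elaborate at type `ℕ` (the
ascription `(v : ℕ)` fixes the binder type), so `List.finRange n` enters through the monadic coercion
`(↑(List.finRange n) : List ℕ)`; membership in it is `· < n`. -/
theorem mem_coe_finRange_iff {n u : ℕ} : u ∈ (↑(List.finRange n) : List ℕ) ↔ u < n := by
  constructor
  · intro h
    simp at h
    obtain ⟨a, rfl⟩ := h
    exact a.isLt
  · intro h
    simp
    exact ⟨⟨u, h⟩, rfl⟩

/-- The edge clause of `i ≠ j` and a non-adjacent (or equal) ordered pair is an axiom. -/
theorem edge_mem_cliqueCNF {n k : ℕ} {adj : Fin n → Fin n → Bool} {i j : ℕ} (hi : i < k)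
    (hj : j < k) (hij : i ≠ j) {u v : Fin n} (huv : adj u v = false) :
    [(i * n + (u : ℕ), false), (j * n + (v : ℕ), false)] ∈ cliqueCNF n k adj := by
  unfold cliqueCNF
  refine List.mem_append_right _ ?_
  refine List.mem_flatMap.2 ⟨i, List.mem_range.2 hi, List.mem_flatMap.2 ⟨j, List.mem_range.2 hj,
    List.mem_flatMap.2 ⟨u, List.mem_finRange u, List.mem_flatMap.2 ⟨v, List.mem_finRange v, ?_⟩⟩⟩⟩
  simp [hij, huv]

/-- A clause of the CNF, as a finset, is an axiom of the `StepList` calculus. -/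
theorem mem_clauseSet_of_mem {φ : CNF ℕ} {c : Clause ℕ} (hc : c ∈ φ) :
    c.toFinset ∈ clauseSet φ :=
  mem_clauseSet_iff.2 ⟨c, hc, rfl⟩

section BruteForce

variable {n k : ℕ} (adj : Fin n → Fin n → Bool)

/-- A block assignment `s : Fin t → Fin n` is CONSISTENT if all cross pairs are adjacent (for a
loopless symmetric `adj`: an ordered `t`-clique). Satisfying assignments of `Clique(adj, k)` are
exactly the consistent `s : Fin k → Fin n`. -/
def Consistent {t : ℕ} (s : Fin t → Fin n) : Prop :=
  ∀ a b : Fin t, a ≠ b → adj (s a) (s b) = true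

/-- Consistency is decidable. -/
instance {t : ℕ} (s : Fin t → Fin n) : Decidable (Consistent adj s) := by
  unfold Consistent; infer_instance

/-- Inconsistency = some cross pair is non-adjacent. -/
theorem not_consistent_iff {t : ℕ} (s : Fin t → Fin n) :
    ¬ Consistent adj s ↔ ∃ a b : Fin t, a ≠ b ∧ adj (s a) (s b) = false := by
  simp [Consistent]

/-- Consistency is inherited by restrictions to an initial segment of the blocks. -/
theorem Consistent.restrict {t t' : ℕ} (h : t' ≤ t) {s : Fin t → Fin n} (hs : Consistent adj s) :
    Consistent adj (fun i : Fin t' => s (Fin.castLE h i)) :=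
  fun _ _ hab => hs _ _ fun e => hab (Fin.castLE_injective h e)

/-- The consistent block assignments of length `t` (`t! ·` the number of `t`-cliques). -/
def cons (t : ℕ) : Finset (Fin t → Fin n) :=
  Finset.univ.filter fun s => Consistent adj s

/-- Membership in `cons`. -/
theorem mem_cons {t : ℕ} {s : Fin t → Fin n} : s ∈ cons adj t ↔ Consistent adj s := by
  simp [cons]

/-- Crude count `C_t ≤ n^t`. -/
theorem card_cons_le (t : ℕ) : (cons adj t).card ≤ n ^ t :=
  (Finset.card_filter_le _ _).trans (by simp)

/-- Above the clique number there are no consistent assignments. -/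
theorem cons_eq_empty_of_forall {w t : ℕ} (hw : ∀ s : Fin (w + 1) → Fin n, ¬ Consistent adj s)
    (ht : w + 1 ≤ t) : cons adj t = ∅ :=
  Finset.filter_eq_empty_iff.2 fun _ _ hs => hw _ (hs.restrict adj ht)

/-- `N(s) = {¬x_{i, s i} : i < t}` for a block assignment `s : Fin t → Fin n`. -/
def nCl (n : ℕ) {t : ℕ} (s : Fin t → Fin n) : Finset (Literal ℕ) :=
  Finset.univ.image fun i : Fin t => ((i : ℕ) * n + (s i : ℕ), false)
/-- `M(s, j) = N(s) ∪ {x_{t,w} : j ≤ w < n}`. -/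
def mCl (n : ℕ) {t : ℕ} (s : Fin t → Fin n) (j : ℕ) : Finset (Literal ℕ) :=
  nCl n s ∪ (Finset.Ico j n).image fun w => (t * n + w, true)
/-- `M(s, n) = N(s)`. -/
theorem mCl_n {t : ℕ} (s : Fin t → Fin n) : mCl n s n = nCl n s := by
  simp [mCl]
/-- The block of level `t`: for every CONSISTENT `s : Fin t → Fin n`, the clauses
`M(s,0), …, M(s,n)`. -/
noncomputable def blk (t : ℕ) : List (Finset (Literal ℕ)) :=
  (cons adj t).toList.flatMap fun s => (List.range (n + 1)).map (mCl n s)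
/-- A level has `C_t · (n+1)` clauses. -/
theorem length_blk (t : ℕ) : (blk adj t).length = (cons adj t).card * (n + 1) := by
  rw [blk, List.length_flatMap]
  have : (fun s : Fin t → Fin n => ((List.range (n + 1)).map (mCl n s)).length) =
      fun _ => n + 1 := by
    funext s; simp
  rw [this, List.map_const', List.sum_replicate, smul_eq_mul, Finset.length_toList]
/-- The clauses `M(s, j)` of a consistent `s` lie in its level. -/
theorem mCl_mem_blk {t : ℕ} {s : Fin t → Fin n} (hs : Consistent adj s) {j : ℕ} (hj : j < n + 1) :
    mCl n s j ∈ blk adj t :=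
  List.mem_flatMap.2 ⟨s, Finset.mem_toList.2 ((mem_cons adj).2 hs),
    List.mem_map.2 ⟨j, List.mem_range.2 hj, rfl⟩⟩
/-- The whole clause list: levels `k, k-1, …, 0`. -/
noncomputable def bruteSteps (k : ℕ) : List (Finset (Literal ℕ)) :=
  (List.range (k + 1)).flatMap fun r => blk adj (k - r)
/-- The empty clause `M(∅, n)` is in the list. -/
theorem empty_mem_bruteSteps : (∅ : Finset (Literal ℕ)) ∈ bruteSteps adj k := by
  refine List.mem_flatMap.2 ⟨k, List.mem_range.2 (Nat.lt_succ_self k), ?_⟩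
  rw [Nat.sub_self]
  have h := mCl_mem_blk adj (t := 0) (s := Fin.elim0) (fun a => a.elim0) (Nat.lt_succ_self n)
  rwa [mCl_n, show nCl n (Fin.elim0 : Fin 0 → Fin n) = ∅ by simp [nCl]] at h
/-- `|l.flatMap g| ≤ |l| · B` when every `g x` has length `≤ B`. -/
theorem length_flatMap_le {α β : Type*} (l : List α) (g : α → List β) (B : ℕ)
    (h : ∀ x ∈ l, (g x).length ≤ B) : (l.flatMap g).length ≤ l.length * B := by
  induction l with
  | nil => simp
  | cons x l ih =>
    rw [List.flatMap_cons, List.length_append, List.length_cons, Nat.succ_mul]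
    have h1 := h x (by simp)
    have h2 := ih fun y hy => h y (by simp [hy])
    omega
/-- Crude count: at most `(k+1)(n+1)^{k+1}` clauses. -/
theorem length_bruteSteps_le : (bruteSteps adj k).length ≤ (k + 1) * (n + 1) ^ (k + 1) := by
  have h := length_flatMap_le (List.range (k + 1)) (fun r => blk adj (k - r)) ((n + 1) ^ (k + 1))
    fun r _ => by
      rw [length_blk, pow_succ]
      exact Nat.mul_le_mul_right _ ((card_cons_le adj _).trans
        ((Nat.pow_le_pow_left (Nat.le_succ n) _).trans
          (Nat.pow_le_pow_right (Nat.succ_pos n) (Nat.sub_le k r))))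
  simpa [bruteSteps] using h
/-- Peeling off the top level. -/
theorem bruteSteps_succ (k : ℕ) : bruteSteps adj (k + 1) = blk adj (k + 1) ++ bruteSteps adj k := by
  unfold bruteSteps
  rw [List.range_succ_eq_map, List.flatMap_cons, Nat.sub_zero, List.flatMap_map]
  congr 1
  congr 1
  funext r
  simp
/-- If no assignment of length `w+1` is consistent, the list has `≤ (w+1)(n+1)^{w+1}` clauses, for any `k`. -/
theorem length_bruteSteps_le_of_cliqueNum {w : ℕ}
    (hw : ∀ s : Fin (w + 1) → Fin n, ¬ Consistent adj s) :
    ∀ k, (bruteSteps adj k).length ≤ (w + 1) * (n + 1) ^ (w + 1) := by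
  intro k
  induction k with
  | zero =>
    refine (length_bruteSteps_le adj).trans ?_
    exact Nat.mul_le_mul (by omega) (Nat.pow_le_pow_right (Nat.succ_pos n) (by omega))
  | succ k ih =>
    rcases Nat.lt_or_ge k w with hk | hk
    · refine (length_bruteSteps_le adj).trans ?_
      exact Nat.mul_le_mul (by omega) (Nat.pow_le_pow_right (Nat.succ_pos n) (by omega))
    · rw [bruteSteps_succ, List.length_append, length_blk,
        cons_eq_empty_of_forall adj hw (by omega), Finset.card_empty, zero_mul, zero_add]
      exact ih
/-- A `flatMap` of step lists is a step list. -/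
theorem stepList_flatMap_of_forall {α : Type*} {A : Set (Finset (Literal ℕ))} {l : List α}
    {g : α → List (Finset (Literal ℕ))} (h : ∀ x ∈ l, StepList A (g x)) :
    StepList A (l.flatMap g) := by
  induction l with
  | nil => simp
  | cons x l ih =>
    rw [List.flatMap_cons]
    exact StepList.append (h x (by simp)) ((ih fun y hy => h y (by simp [hy])).mono
      Set.subset_union_left)

/-- One level of the brute-force refutation is a step list over the axioms and the clauses `N(s')` of the
consistent `s' : Fin (t+1) → Fin n` above: `M(s,0)` weakens the clique clause of block `t`; `M(s,j+1)` resolves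
`M(s,j)` on `x_{t,j}` with `N(s⌢j)` if `s⌢j` is consistent, else with an edge axiom `¬x_{i,s i} ∨ ¬x_{t,j}`. -/
theorem stepList_blk (hfree : ∀ s : Fin k → Fin n, ¬ Consistent adj s) {t : ℕ} (ht : t ≤ k) :
    StepList (clauseSet (cliqueCNF n k adj) ∪
      {C | t < k ∧ ∃ s' : Fin (t + 1) → Fin n, Consistent adj s' ∧ C = nCl n s'}) (blk adj t) := by
  refine stepList_flatMap_of_forall fun s hs => stepList_map_range fun j hj => ?_
  have hsC : Consistent adj s := (mem_cons adj).1 (Finset.mem_toList.1 hs)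
  rcases Nat.lt_or_ge t k with htk | htk
  swap
  · -- top level `t = k`: no consistent `s` exists
    have e : t = k := le_antisymm ht htk
    subst e
    exact absurd hsC (hfree s)
  rcases j with _ | j
  · -- `M(s,0)` is a weakening of the clique-member clause of block `t`
    refine DerivStep.of_mem (Or.inl (Or.inl (mem_clauseSet_of_mem
      (clique_mem_cliqueCNF adj htk)))) ?_
    intro l hl
    obtain ⟨v, hv, rfl⟩ := List.mem_map.1 (List.mem_toFinset.1 hl)
    simp only [mCl, Finset.mem_union, Finset.mem_image, Finset.mem_Ico]
    exact Or.inr ⟨v, ⟨Nat.zero_le _, mem_coe_finRange_iff.1 hv⟩, rfl⟩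
  · have hjn : j < n := by omega
    set s' : Fin (t + 1) → Fin n := Fin.snoc s ⟨j, hjn⟩ with hs'
    -- the common subset facts
    have hD : (t * n + j, true) ∈ mCl n s j := by
      simp only [mCl, Finset.mem_union, Finset.mem_image, Finset.mem_Ico]
      exact Or.inr ⟨j, ⟨le_rfl, hjn⟩, rfl⟩
    have hDsub : (mCl n s j).erase (t * n + j, true) ⊆ mCl n s (j + 1) := by
      intro l hl
      simp only [mCl, Finset.mem_erase, Finset.mem_union, Finset.mem_image, Finset.mem_Ico]
        at hl ⊢
      obtain ⟨hne, hN | ⟨w, ⟨hjw, hwn⟩, rfl⟩⟩ := hl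
      · exact Or.inl hN
      · refine Or.inr ⟨w, ⟨?_, hwn⟩, rfl⟩
        rcases Nat.eq_or_lt_of_le hjw with rfl | h
        · exact absurd rfl hne
        · exact h
    have hNsub : ∀ i : Fin t, ((i : ℕ) * n + (s i : ℕ), false) ∈ mCl n s (j + 1) := fun i => by
      simp only [mCl, Finset.mem_union, nCl, Finset.mem_image, Finset.mem_univ, true_and]
      exact Or.inl ⟨i, rfl⟩
    by_cases hc : Consistent adj s'
    · -- resolve with `N(s')`, available from level `t+1 < k`
      have ht1 : t + 1 < k := by
        by_contra h1
        have e : t + 1 = k := by omega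
        subst e
        exact hfree s' hc
      refine DerivStep.of_res (D := mCl n s j) (E := nCl n s') (v := t * n + j)
        (Or.inr ⟨j, Nat.lt_succ_self j, rfl⟩) (Or.inl (Or.inr ⟨htk, s', hc, rfl⟩)) hD ?_ hDsub ?_
      · simp only [nCl, Finset.mem_image, Finset.mem_univ, true_and]
        exact ⟨Fin.last t, by simp [hs']⟩
      · intro l hl
        simp only [Finset.mem_erase, nCl, Finset.mem_image, Finset.mem_univ, true_and] at hl
        obtain ⟨hne, i, rfl⟩ := hl
        rcases Fin.eq_castSucc_or_eq_last i with ⟨i, rfl⟩ | rfl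
        · simpa [hs'] using hNsub i
        · exact absurd (by simp [hs']) hne
    · -- resolve with the edge axiom of a non-adjacent pair, which must involve block `t`
      obtain ⟨a, b, hab, hadj⟩ := (not_consistent_iff adj s').1 hc
      -- one of `a`, `b` is the new block `t`
      have key : ∃ i : Fin t, (adj (s i) ⟨j, hjn⟩ = false ∨ adj ⟨j, hjn⟩ (s i) = false) := by
        rcases Fin.eq_castSucc_or_eq_last a with ⟨a, rfl⟩ | rfl <;>
          rcases Fin.eq_castSucc_or_eq_last b with ⟨b, rfl⟩ | rfl
        · exfalso
          have := hsC a b fun e => hab (by rw [e])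
          simp [hs'] at hadj
          simp [hadj] at this
        · exact ⟨a, Or.inl (by simpa [hs'] using hadj)⟩
        · exact ⟨b, Or.inr (by simpa [hs'] using hadj)⟩
        · exact absurd rfl hab
      obtain ⟨i, hi⟩ := key
      have hit : (i : ℕ) ≠ t := Nat.ne_of_lt i.isLt
      -- the axiom as a finset, in either orientation
      have hax : ({((i : ℕ) * n + (s i : ℕ), false), (t * n + j, false)} : Finset (Literal ℕ)) ∈
          clauseSet (cliqueCNF n k adj) := by
        rcases hi with hi | hi
        · have := mem_clauseSet_of_mem (edge_mem_cliqueCNF (i.isLt.trans htk) htk hit hi)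
          simpa using this
        · have := mem_clauseSet_of_mem (edge_mem_cliqueCNF htk (i.isLt.trans htk) hit.symm hi)
          simp only [List.toFinset_cons, List.toFinset_nil, Finset.insert_empty] at this
          rwa [Finset.pair_comm] at this
      refine DerivStep.of_res (D := mCl n s j)
        (E := {((i : ℕ) * n + (s i : ℕ), false), (t * n + j, false)}) (v := t * n + j)
        (Or.inr ⟨j, Nat.lt_succ_self j, rfl⟩) (Or.inl (Or.inl hax)) hD (by simp) hDsub ?_
      intro l hl
      simp only [Finset.mem_erase, Finset.mem_insert, Finset.mem_singleton] at hl
      obtain ⟨hne, rfl | rfl⟩ := hl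
      · exact hNsub i
      · exact absurd rfl hne

/-- The whole brute-force clause list is a step list from the axioms. -/
theorem stepList_bruteSteps (hfree : ∀ s : Fin k → Fin n, ¬ Consistent adj s) :
    StepList (clauseSet (cliqueCNF n k adj)) (bruteSteps adj k) := by
  refine stepList_flatMap_range fun r hr => (stepList_blk adj hfree (Nat.sub_le k r)).mono ?_
  rintro C (hC | ⟨hlt, s', hs', rfl⟩)
  · exact Or.inl hC
  · refine Or.inr ⟨r - 1, by omega, ?_⟩
    have e : k - (r - 1) = k - r + 1 := by omega
    rw [e, ← mCl_n]
    exact mCl_mem_blk adj hs' (Nat.lt_succ_self n)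

/-- **Tightness (brute force).** If no `Fin k → Fin n` is consistent, `Clique(adj, k)` has a resolution
refutation with at most `4 · |bruteSteps|` lines (the decision tree over block assignments). -/
theorem exists_refutation_le_length (hfree : ∀ s : Fin k → Fin n, ¬ Consistent adj s) :
    ∃ π : List (ResLine ℕ), IsResRefutation (cliqueCNF n k adj) π ∧
      π.length ≤ 4 * (bruteSteps adj k).length := by
  obtain ⟨π, hπ, hlen, hall⟩ := (stepList_bruteSteps adj hfree).exists_isResDerivation
  obtain ⟨l, hl, hl0⟩ := hall ∅ (empty_mem_bruteSteps adj)
  exact ⟨π, ⟨hπ, l, hl, hl0⟩, hlen⟩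

/-- The clause count in closed form: `(n+1) Σ_{t ≤ k} C_t`. -/
theorem length_bruteSteps_eq (k : ℕ) :
    (bruteSteps adj k).length = (n + 1) * ∑ t ∈ Finset.range (k + 1), (cons adj t).card := by
  induction k with
  | zero => simp [bruteSteps, length_blk, mul_comm]
  | succ k ih =>
    rw [bruteSteps_succ, List.length_append, ih, length_blk, Finset.sum_range_succ _ (k + 1)]
    ring

/-- **Tightness (clique-count form).** `≤ 4 (n+1) Σ_{t ≤ k} C_t` lines. -/
theorem exists_refutation_le_count (hfree : ∀ s : Fin k → Fin n, ¬ Consistent adj s) :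
    ∃ π : List (ResLine ℕ), IsResRefutation (cliqueCNF n k adj) π ∧
      π.length ≤ 4 * ((n + 1) * ∑ t ∈ Finset.range (k + 1), (cons adj t).card) := by
  obtain ⟨π, hπ, hlen⟩ := exists_refutation_le_length adj hfree
  exact ⟨π, hπ, by rwa [length_bruteSteps_eq] at hlen⟩

/-- **Tightness (brute force).** `≤ 4 (k+1) (n+1)^{k+1}` lines for every `adj` without a
consistent `k`-assignment. -/
theorem exists_refutation_le_pow (hfree : ∀ s : Fin k → Fin n, ¬ Consistent adj s) :
    ∃ π : List (ResLine ℕ), IsResRefutation (cliqueCNF n k adj) π ∧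
      π.length ≤ 4 * ((k + 1) * (n + 1) ^ (k + 1)) := by
  obtain ⟨π, hπ, hlen⟩ := exists_refutation_le_length adj hfree
  exact ⟨π, hπ, hlen.trans (Nat.mul_le_mul_left 4 (length_bruteSteps_le adj))⟩

/-- **Tightness governed by the clique number**: `≤ 4 (w+1) (n+1)^{w+1}` lines if no `Fin (w+1) → Fin n`
is consistent (`ω ≤ w`), independently of `k`. -/
theorem exists_refutation_le_pow_cliqueNum (hfree : ∀ s : Fin k → Fin n, ¬ Consistent adj s)
    {w : ℕ} (hw : ∀ s : Fin (w + 1) → Fin n, ¬ Consistent adj s) :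
    ∃ π : List (ResLine ℕ), IsResRefutation (cliqueCNF n k adj) π ∧
      π.length ≤ 4 * ((w + 1) * (n + 1) ^ (w + 1)) := by
  obtain ⟨π, hπ, hlen⟩ := exists_refutation_le_length adj hfree
  exact ⟨π, hπ, hlen.trans (Nat.mul_le_mul_left 4 (length_bruteSteps_le_of_cliqueNum adj hw k))⟩

end BruteForce

/-- `K_k`-freeness of a simple graph in the formula's terms: no block assignment is consistent. -/
theorem cliqueFree_iff_forall_not_consistent {n k : ℕ} (G : SimpleGraph (Fin n)) [DecidableRel G.Adj] :
    G.CliqueFree k ↔ ∀ s : Fin k → Fin n, ¬ Consistent (fun u v => decide (G.Adj u v)) s := by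
  constructor
  · intro h s hs
    have hadj : ∀ i j : Fin k, i ≠ j → G.Adj (s i) (s j) := fun i j hij => by
      simpa using hs i j hij
    have hinj : Function.Injective s := fun i j hij => by
      by_contra hne
      have h' := hadj i j hne
      rw [hij] at h'
      exact G.irrefl h'
    refine h (Finset.univ.image s) ⟨?_, ?_⟩
    · intro x hx y hy hxy
      obtain ⟨i, -, rfl⟩ := Finset.mem_image.1 (Finset.mem_coe.1 hx)
      obtain ⟨j, -, rfl⟩ := Finset.mem_image.1 (Finset.mem_coe.1 hy)
      exact hadj i j fun hij => hxy (congrArg s hij)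
    · rw [Finset.card_image_of_injective _ hinj, Finset.card_univ, Fintype.card_fin]
  · intro h t ht
    have hcard : t.card = k := ht.card_eq
    refine h (fun i => t.orderEmbOfFin hcard i) fun i j hij => ?_
    have hne : t.orderEmbOfFin hcard i ≠ t.orderEmbOfFin hcard j := fun e =>
      hij ((t.orderEmbOfFin hcard).injective e)
    have : G.Adj (t.orderEmbOfFin hcard i) (t.orderEmbOfFin hcard j) :=
      ht.isClique (Finset.orderEmbOfFin_mem t hcard i) (Finset.orderEmbOfFin_mem t hcard j) hne
    simpa using this

/-- **Tightness at the item's threshold**: every `K_{k(n)}`-free `G` has a refutation of `Clique(G, k(n))`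
with `≤ 4 (k(n)+1) (n+1)^{k(n)+1} = n^{(2+o(1)) log₂ n}` lines; so the item can only hold with `ε ≤ 2`. -/
theorem exists_refutation_at_threshold {n : ℕ} (G : SimpleGraph (Fin n)) [DecidableRel G.Adj]
    (hG : G.CliqueFree (kR n)) :
    ∃ π : List (ResLine ℕ), IsResRefutation (cliqueCNF n (kR n) fun u v => decide (G.Adj u v)) π ∧
      π.length ≤ 4 * ((kR n + 1) * (n + 1) ^ (kR n + 1)) :=
  exists_refutation_le_pow _ ((cliqueFree_iff_forall_not_consistent G).1 hG)

/-- **Tightness at the threshold, clique-number form** (registered stub, binder-free): if `ω(G) ≤ w` the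
item's `G`-side costs `≤ 4 (w+1) (n+1)^{w+1} = n^{ω(G)+O(1)}` lines (and the `Ḡ`-side `n^{α(G)+O(1)}`), so
hardness `n^{ε log₂ n}` needs BOTH `ω(G), α(G) ≥ (ε - o(1)) log₂ n`. -/
theorem exists_refutation_at_threshold_cliqueNum :
    ∀ {n w : ℕ} (G : SimpleGraph (Fin n)) [DecidableRel G.Adj], G.CliqueFree (kR n) → G.CliqueFree (w + 1) → ∃ π : List (ResLine ℕ), IsResRefutation (cliqueCNF n (kR n) fun u v => decide (G.Adj u v)) π ∧ π.length ≤ 4 * ((w + 1) * (n + 1) ^ (w + 1)) :=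
  fun G _ hG hw => exists_refutation_le_pow_cliqueNum _ ((cliqueFree_iff_forall_not_consistent G).1 hG)
    ((cliqueFree_iff_forall_not_consistent G).1 hw)

end Summit.PneNP.PneNP.Theorems.ResolutionUncertainty.Negative
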